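import Summits.QuantumFields.YangMills.Theses.SqueezedSkewness

/-!
# `SqueezedSkewness.VacuumDominationKLGlue` — proved (support item `stmt-QuantumFields-22663`)

Route `SqueezedSkewness` rev 9 (planner ym-idea-6 g8, LINE 1 «KL split» of the crux `VacuumDomination`,
stmt-QuantumFields-28192): the glue `ThermalLimit → SpectralIdentification → VacuumDomination`.

PROOF (real analysis only).  Fix `G, r, β, L, s, R, c, f, g` as in `VacuumDomination`, with
`c‖LF_s g(E,p)‖ ≤ ‖LF_s f(E,p)‖` for all `E ≥ 0`, `p`.  `ThermalLimit` gives the limits `Q_f`, `Q_g` of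
the reflection forms `Qrp_k(f)`, `Qrp_k(g)`; `SpectralIdentification` gives ONE `f`-independent family
`(W_n ≥ 0, μ_n ∈ [0,1], p_n)` with `HasSum (W_n‖amp_s f(μ_n,p_n)‖²) Q_f` and the same for `g`.
(1) For `μ = e^{−Es} ∈ (0,1]` one has `amp_s f(μ,p) = e^{Es}·LF_s f(E,p)` TERMWISE: on the lattice
support of `f` the time coordinate is `x₀ ≥ 1` (`tsupport f ⊆ {y₀ > 0}`), so
`μ^{toNat(x₀−1)} = e^{−Es(x₀−1)}`; hence `c‖amp_s g(μ,p)‖ ≤ ‖amp_s f(μ,p)‖` on `(0,1]`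
(`E = −log μ / s ≥ 0`).  (2) `μ ↦ amp_s f(μ,p)` is a FINITE sum of monomials (`tsupport f ⊆
closedBall 0 R` makes the lattice support finite), hence continuous, and the inequality passes to
`μ = 0` along `μ = 1/(n+1)`.  (3) `hasSum_le` gives `c²Q_g ≤ Q_f`; the eventual floor `ε ≤ Qrp_k(g)`
gives `ε ≤ Q_g`; so `ε' < c²ε ≤ Q_f` and `Qrp_k(f) → Q_f` is eventually `> ε'`.

HONEST SCOPE.  Plumbing of a LINE onto the rung leaf `BalabanLadder.NT` (R2a): the line's content
(`ThermalLimit`, `SpectralIdentification`, `HighBallFloors`, …), the rung and every summit statement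
stay open; nothing here bears on the Yang–Mills mass gap.  No definitions, no named facts. [folklore]
-/

noncomputable section

open scoped BigOperators
open MeasureTheory Filter Topology Set Metric
open Literature.MathematicalPhysics.QuantumLattice

namespace Summit.QuantumFields.YangMills.Theorems.SqueezedSkewnessVacuumDominationKLGlue

/-! ### 1. The lattice support of a compactly supported test function is finite -/

/-- For `s > 0` and `tsupport f ⊆ closedBall 0 R`, only finitely many lattice points `x ∈ ℤ⁴` have
`f(s x) ≠ 0`. [folklore] -/
theorem finite_latticeSupport (f : SchwartzMap (EuclideanSpace ℝ (Fin 4)) ℝ) {s R : ℝ} (hs : 0 < s)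
    (hfR : tsupport (f : EuclideanSpace ℝ (Fin 4) → ℝ)
      ⊆ Metric.closedBall (0 : EuclideanSpace ℝ (Fin 4)) R) :
    Set.Finite {x : Fin 4 → ℤ | f (s • siteToE (d := 4) x) ≠ 0} := by
  refine (Set.Finite.pi (fun _ : Fin 4 => Set.finite_Icc (-⌈R / s⌉) ⌈R / s⌉)).subset ?_
  intro x hx
  rw [Set.mem_univ_pi]
  intro i
  have hmem : s • siteToE (d := 4) x ∈ tsupport (f : EuclideanSpace ℝ (Fin 4) → ℝ) :=
    subset_tsupport _ hx
  have hball := hfR hmem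
  rw [Metric.mem_closedBall, dist_zero_right] at hball
  have hi : ‖(s • siteToE (d := 4) x) i‖ ≤ ‖s • siteToE (d := 4) x‖ := PiLp.norm_apply_le _ i
  have hcoord : (s • siteToE (d := 4) x) i = s * (x i : ℝ) := by simp [siteToE_apply]
  rw [hcoord, Real.norm_eq_abs, abs_mul, abs_of_pos hs] at hi
  have habs : |(x i : ℝ)| ≤ R / s := by
    rw [le_div_iff₀ hs, mul_comm]; exact hi.trans hball
  obtain ⟨h1, h2⟩ := abs_le.mp habs
  have hceil := Int.le_ceil (R / s)
  constructor
  · have : ((-⌈R / s⌉ : ℤ) : ℝ) ≤ x i := by push_cast; linarith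
    exact_mod_cast this
  · have : (x i : ℝ) ≤ ((⌈R / s⌉ : ℤ) : ℝ) := h2.trans hceil
    exact_mod_cast this

/-! ### 2. The amplitude at `μ = e^{-Es}` is `e^{Es}` times the Laplace–Fourier sum -/

/-- On the lattice support of a test function supported in `{y₀ > 0}` the time coordinate is `≥ 1`.
[folklore] -/
theorem one_le_of_ne_zero (f : SchwartzMap (EuclideanSpace ℝ (Fin 4)) ℝ) {s : ℝ} (hs : 0 < s)
    (hf0 : tsupport (f : EuclideanSpace ℝ (Fin 4) → ℝ) ⊆ {y : EuclideanSpace ℝ (Fin 4) | 0 < y 0})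
    {x : Fin 4 → ℤ} (hx : f (s • siteToE (d := 4) x) ≠ 0) : 1 ≤ x 0 := by
  have hmem : s • siteToE (d := 4) x ∈ tsupport (f : EuclideanSpace ℝ (Fin 4) → ℝ) :=
    subset_tsupport _ hx
  have hpos : 0 < (s • siteToE (d := 4) x) 0 := hf0 hmem
  have hcoord : (s • siteToE (d := 4) x) 0 = s * (x 0 : ℝ) := by simp [siteToE_apply]
  rw [hcoord] at hpos
  have hx0 : (0 : ℝ) < x 0 := (mul_pos_iff_of_pos_left hs).mp hpos
  have hx0' : (0 : ℤ) < x 0 := by exact_mod_cast hx0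
  omega

/-- `amp_s f(e^{−Es}, p) = e^{Es} · LF_s f(E, p)` for `tsupport f ⊆ {y₀ > 0}`. [folklore] -/
theorem amp_exp_eq (f : SchwartzMap (EuclideanSpace ℝ (Fin 4)) ℝ) {s : ℝ} (hs : 0 < s)
    (hf0 : tsupport (f : EuclideanSpace ℝ (Fin 4) → ℝ) ⊆ {y : EuclideanSpace ℝ (Fin 4) | 0 < y 0})
    (E : ℝ) (p : Fin 3 → ℝ) :
    ∑' x : Fin 4 → ℤ, (((f (s • siteToE (d := 4) x) * Real.exp (-(E * s)) ^ (Int.toNat (x 0 - 1))) : ℝ) : ℂ)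
        * Complex.exp (Complex.I * ((s * ∑ k : Fin 3, p k * (x k.succ : ℝ) : ℝ) : ℂ))
      = (Real.exp (E * s) : ℂ) * ∑' x : Fin 4 → ℤ,
          (((f (s • siteToE (d := 4) x) * Real.exp (-(E * (s * (x 0 : ℝ))))) : ℝ) : ℂ)
            * Complex.exp (Complex.I * ((s * ∑ k : Fin 3, p k * (x k.succ : ℝ) : ℝ) : ℂ)) := by
  rw [← tsum_mul_left]
  refine tsum_congr fun x => ?_
  by_cases hx : f (s • siteToE (d := 4) x) = 0
  · simp [hx]
  · have hx0 : 1 ≤ x 0 := one_le_of_ne_zero f hs hf0 hx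
    have h := Int.toNat_of_nonneg (sub_nonneg.mpr hx0)
    have hN : (((x 0 - 1).toNat : ℕ) : ℝ) = (x 0 : ℝ) - 1 := by
      rw [← Int.cast_natCast, h]; push_cast; ring
    rw [← Real.exp_nat_mul, hN,
      show ((x 0 : ℝ) - 1) * (-(E * s)) = E * s + (-(E * (s * (x 0 : ℝ)))) by ring, Real.exp_add]
    push_cast
    ring

/-! ### 3. Domination of amplitudes for `μ ∈ (0, 1]` -/

/-- `c‖amp_s g(μ,p)‖ ≤ ‖amp_s f(μ,p)‖` for `0 < μ ≤ 1`, from the domination of the Laplace–Fourier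
sums at `E = −log μ / s ≥ 0`. [folklore] -/
theorem amp_dom_pos (f g : SchwartzMap (EuclideanSpace ℝ (Fin 4)) ℝ) {s c : ℝ} (hs : 0 < s)
    (hf0 : tsupport (f : EuclideanSpace ℝ (Fin 4) → ℝ) ⊆ {y : EuclideanSpace ℝ (Fin 4) | 0 < y 0})
    (hg0 : tsupport (g : EuclideanSpace ℝ (Fin 4) → ℝ) ⊆ {y : EuclideanSpace ℝ (Fin 4) | 0 < y 0})
    (hdom : ∀ E : ℝ, 0 ≤ E → ∀ p : Fin 3 → ℝ,
      c * ‖∑' x : Fin 4 → ℤ, (((g (s • siteToE (d := 4) x) * Real.exp (-(E * (s * (x 0 : ℝ))))) : ℝ) : ℂ)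
            * Complex.exp (Complex.I * ((s * ∑ k : Fin 3, p k * (x k.succ : ℝ) : ℝ) : ℂ))‖
        ≤ ‖∑' x : Fin 4 → ℤ, (((f (s • siteToE (d := 4) x) * Real.exp (-(E * (s * (x 0 : ℝ))))) : ℝ) : ℂ)
            * Complex.exp (Complex.I * ((s * ∑ k : Fin 3, p k * (x k.succ : ℝ) : ℝ) : ℂ))‖)
    {μ : ℝ} (hμ : 0 < μ) (hμ1 : μ ≤ 1) (p : Fin 3 → ℝ) :
    c * ‖∑' x : Fin 4 → ℤ, (((g (s • siteToE (d := 4) x) * μ ^ (Int.toNat (x 0 - 1))) : ℝ) : ℂ)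
          * Complex.exp (Complex.I * ((s * ∑ k : Fin 3, p k * (x k.succ : ℝ) : ℝ) : ℂ))‖
      ≤ ‖∑' x : Fin 4 → ℤ, (((f (s • siteToE (d := 4) x) * μ ^ (Int.toNat (x 0 - 1))) : ℝ) : ℂ)
          * Complex.exp (Complex.I * ((s * ∑ k : Fin 3, p k * (x k.succ : ℝ) : ℝ) : ℂ))‖ := by
  set E : ℝ := -Real.log μ / s with hEdef
  have hE : 0 ≤ E := div_nonneg (neg_nonneg.mpr (Real.log_nonpos hμ.le hμ1)) hs.le
  have hμE : Real.exp (-(E * s)) = μ := by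
    rw [hEdef, div_mul_cancel₀ _ hs.ne', neg_neg, Real.exp_log hμ]
  rw [← hμE, amp_exp_eq f hs hf0 E p, amp_exp_eq g hs hg0 E p, norm_mul, norm_mul, Complex.norm_real,
    Real.norm_of_nonneg (Real.exp_pos _).le]
  have h := mul_le_mul_of_nonneg_left (hdom E hE p) (Real.exp_pos (E * s)).le
  linarith

/-! ### 4. Continuity of the amplitude in `μ`, and the case `μ = 0` -/

/-- `μ ↦ amp_s f(μ,p)` is continuous: a finite sum of monomials. [folklore] -/
theorem continuous_amp (f : SchwartzMap (EuclideanSpace ℝ (Fin 4)) ℝ) {s R : ℝ} (hs : 0 < s)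
    (hfR : tsupport (f : EuclideanSpace ℝ (Fin 4) → ℝ)
      ⊆ Metric.closedBall (0 : EuclideanSpace ℝ (Fin 4)) R) (p : Fin 3 → ℝ) :
    Continuous (fun μ : ℝ => ∑' x : Fin 4 → ℤ,
      (((f (s • siteToE (d := 4) x) * μ ^ (Int.toNat (x 0 - 1))) : ℝ) : ℂ)
        * Complex.exp (Complex.I * ((s * ∑ k : Fin 3, p k * (x k.succ : ℝ) : ℝ) : ℂ))) := by
  have hfin := finite_latticeSupport f hs hfR
  have heq : (fun μ : ℝ => ∑' x : Fin 4 → ℤ,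
      (((f (s • siteToE (d := 4) x) * μ ^ (Int.toNat (x 0 - 1))) : ℝ) : ℂ)
        * Complex.exp (Complex.I * ((s * ∑ k : Fin 3, p k * (x k.succ : ℝ) : ℝ) : ℂ)))
      = fun μ : ℝ => ∑ x ∈ hfin.toFinset,
          (((f (s • siteToE (d := 4) x) * μ ^ (Int.toNat (x 0 - 1))) : ℝ) : ℂ)
            * Complex.exp (Complex.I * ((s * ∑ k : Fin 3, p k * (x k.succ : ℝ) : ℝ) : ℂ)) := by
    funext μ
    apply tsum_eq_sum
    intro x hx
    have hx' : f (s • siteToE (d := 4) x) = 0 := by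
      by_contra h
      exact hx (hfin.mem_toFinset.mpr h)
    simp [hx']
  rw [heq]
  fun_prop

/-- `c‖amp_s g(μ,p)‖ ≤ ‖amp_s f(μ,p)‖` for all `μ ∈ [0,1]` (the endpoint `μ = 0` by continuity along
`μ = 1/(n+1)`). [folklore] -/
theorem amp_dom (f g : SchwartzMap (EuclideanSpace ℝ (Fin 4)) ℝ) {s c R : ℝ} (hs : 0 < s)
    (hf0 : tsupport (f : EuclideanSpace ℝ (Fin 4) → ℝ) ⊆ {y : EuclideanSpace ℝ (Fin 4) | 0 < y 0})
    (hfR : tsupport (f : EuclideanSpace ℝ (Fin 4) → ℝ)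
      ⊆ Metric.closedBall (0 : EuclideanSpace ℝ (Fin 4)) R)
    (hg0 : tsupport (g : EuclideanSpace ℝ (Fin 4) → ℝ) ⊆ {y : EuclideanSpace ℝ (Fin 4) | 0 < y 0})
    (hgR : tsupport (g : EuclideanSpace ℝ (Fin 4) → ℝ)
      ⊆ Metric.closedBall (0 : EuclideanSpace ℝ (Fin 4)) R)
    (hdom : ∀ E : ℝ, 0 ≤ E → ∀ p : Fin 3 → ℝ,
      c * ‖∑' x : Fin 4 → ℤ, (((g (s • siteToE (d := 4) x) * Real.exp (-(E * (s * (x 0 : ℝ))))) : ℝ) : ℂ)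
            * Complex.exp (Complex.I * ((s * ∑ k : Fin 3, p k * (x k.succ : ℝ) : ℝ) : ℂ))‖
        ≤ ‖∑' x : Fin 4 → ℤ, (((f (s • siteToE (d := 4) x) * Real.exp (-(E * (s * (x 0 : ℝ))))) : ℝ) : ℂ)
            * Complex.exp (Complex.I * ((s * ∑ k : Fin 3, p k * (x k.succ : ℝ) : ℝ) : ℂ))‖)
    {μ : ℝ} (hμ0 : 0 ≤ μ) (hμ1 : μ ≤ 1) (p : Fin 3 → ℝ) :
    c * ‖∑' x : Fin 4 → ℤ, (((g (s • siteToE (d := 4) x) * μ ^ (Int.toNat (x 0 - 1))) : ℝ) : ℂ)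
          * Complex.exp (Complex.I * ((s * ∑ k : Fin 3, p k * (x k.succ : ℝ) : ℝ) : ℂ))‖
      ≤ ‖∑' x : Fin 4 → ℤ, (((f (s • siteToE (d := 4) x) * μ ^ (Int.toNat (x 0 - 1))) : ℝ) : ℂ)
          * Complex.exp (Complex.I * ((s * ∑ k : Fin 3, p k * (x k.succ : ℝ) : ℝ) : ℂ))‖ := by
  rcases hμ0.eq_or_lt with h | h
  · subst h
    have hseq : Tendsto (fun n : ℕ => (1 : ℝ) / ((n : ℝ) + 1)) atTop (𝓝 0) :=
      tendsto_one_div_add_atTop_nhds_zero_nat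
    have hcg := (((continuous_amp g hs hgR p).norm.tendsto 0).comp hseq).const_mul c
    have hcf := ((continuous_amp f hs hfR p).norm.tendsto 0).comp hseq
    refine le_of_tendsto_of_tendsto' hcg hcf (fun n => ?_)
    have hn : (0 : ℝ) < (n : ℝ) + 1 := by positivity
    exact amp_dom_pos f g hs hf0 hg0 hdom (by positivity)
      (by rw [div_le_one hn]; linarith) p
  · exact amp_dom_pos f g hs hf0 hg0 hdom h hμ1 p

/-- Squares of dominated non-negative quantities, weighted. [folklore] -/
theorem sq_dom {c a b W : ℝ} (hc : 0 ≤ c) (hW : 0 ≤ W) (ha : 0 ≤ a) (h : c * a ≤ b) :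
    c ^ 2 * (W * a ^ 2) ≤ W * b ^ 2 := by
  have h1 : (c * a) ^ 2 ≤ b ^ 2 := pow_le_pow_left₀ (mul_nonneg hc ha) h 2
  nlinarith

/-! ### 5. The item -/

/-- **`VacuumDominationKLGlue` holds** (item `stmt-QuantumFields-22663`, by name):
`ThermalLimit → SpectralIdentification → VacuumDomination`.  Plumbing of a line onto
`BalabanLadder.NT`; no summit statement is affected. [folklore] -/
theorem vacuumDominationKLGlue_proof :
    Summit.QuantumFields.YangMills.Theses.SqueezedSkewness.VacuumDominationKLGlue := by
  intro hT hS G _ _ _ _ r St Cfg cc posE P A w E Cov refl B Qrp LF β L s R c f g hβ hL hs hc hf0 hfR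
    hg0 hgR hRL hdom ε ε' hε' hfloor
  obtain ⟨k₀, hk₀⟩ := hfloor
  obtain ⟨Qf, hQf⟩ := hT G r β L s R f hβ hL hs hf0 hfR hRL
  obtain ⟨Qg, hQg⟩ := hT G r β L s R g hβ hL hs hg0 hgR hRL
  obtain ⟨W, μ, q, hW, hμ, hspec⟩ := hS G r β L s hβ hL hs
  have hFf := hspec R f hf0 hfR hRL Qf hQf
  have hFg := hspec R g hg0 hgR hRL Qg hQg
  -- termwise domination of the amplitudes (μ ∈ [0,1])
  have hamp := fun n => amp_dom f g hs hf0 hfR hg0 hgR hdom (hμ n).1 (hμ n).2 (q n)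
  -- compare the two non-negative series
  have hQ : c ^ 2 * Qg ≤ Qf :=
    hasSum_le (fun n => sq_dom hc (hW n) (norm_nonneg _) (hamp n)) (hFg.mul_left (c ^ 2)) hFf
  have hεQ : ε ≤ Qg := ge_of_tendsto hQg (Filter.eventually_atTop.mpr ⟨k₀, hk₀⟩)
  have hlt : ε' < Qf := by
    have : c ^ 2 * ε ≤ c ^ 2 * Qg := mul_le_mul_of_nonneg_left hεQ (sq_nonneg c)
    linarith
  obtain ⟨k₁, hk₁⟩ := Filter.eventually_atTop.mp (hQf.eventually (lt_mem_nhds hlt))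
  exact ⟨k₁, fun k hk => (hk₁ k hk).le⟩

end Summit.QuantumFields.YangMills.Theorems.SqueezedSkewnessVacuumDominationKLGlue

end
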